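import Mathlib
import HarnessLib
import Literature.Probability.MarkovChains.RelaxationTimeLowerBound

/-!
# `λ⋆`, the absolute spectral gap `γ⋆ = 1 − λ⋆`, the relaxation time `t_rel = 1/γ⋆`, and `t_mix(ε) ≥ (t_rel − 1) log(1/(2ε))` (Levin–Peres–Wilmer eq. (12.14))

HONEST FRAMING: exact (Metropolis-corrected) sampling algorithms for lattice gauge theory; figures
of merit are autocorrelation/cost numbers at stated couplings and volumes; no continuum-physics claim.

Conventions of `TotalVariation.lean` / `BottleneckRatio.lean` / `RelaxationTimeLowerBound.lean`
(finite `X`, ROW kernel `P : X → X → ℝ`, `d(t) = worstTvDist P π t`, `t_mix(ε) = mixingTime P π ε`;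
eigenvalues of `P` = eigenvalues of the linear map `Matrix.toLin'` of the complexified matrix, i.e.
`λ ∈ ℂ` with `Pf = λf` for some `f ≠ 0`, `(Pf)(x) = Σ_y P(x,y) f(y)` — `hasEigenvector_iff`).
Source: D. A. Levin, Y. Peres (with E. L. Wilmer), *Markov Chains and Mixing Times*, 2nd ed.,
AMS 2017 [LevinPeres2017], §12.2.  Everything is PROVED (finite sums; 0 named facts).

* `lambdaStar P = λ⋆ = max {|λ| : λ an eigenvalue of P, λ ≠ 1}` [cite: LevinPeres2017, §12.2
  eq. (12.6)] (as `sSup` over the finite set of eigenvalues `≠ 1`; junk value `0` when `P` has no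
  eigenvalue other than `1`, e.g. `P = I`); `norm_le_lambdaStar`, `exists_norm_eq_lambdaStar`
  (the maximum is attained), `lambdaStar_nonneg`, `lambdaStar_le_one` (Lemma 12.1 (i));
* `absSpectralGap P = γ⋆ = 1 − λ⋆` and `relaxationTime P = t_rel = 1/γ⋆` [cite: LevinPeres2017,
  §12.2 (the two displays after eq. (12.6))] — the book defines `t_rel` "of a reversible Markov
  chain"; the definition and the inequality below do not use reversibility (for a reversible `P`
  the eigenvalues are real and `γ⋆` is the absolute spectral gap of (12.7); positivity of `γ⋆`
  for irreducible aperiodic `P` — Lemma 12.1 — is not formalised and enters as the hypothesis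
  `λ⋆ < 1`);
* **eq. (12.14)** `LevinPeres2017_eq_12_14`: `(t_rel − 1)·log(1/(2ε)) ≤ t` for every `t` with
  `d(t) ≤ ε` (`ε > 0`, `λ⋆ < 1`, `πP = π`), and `LevinPeres2017_eq_12_14_tmix`, the same with
  `t = t_mix(ε)` for a chain that is `ε`-close at some time [cite: LevinPeres2017, §12.2 Thm 12.5
  eq. (12.14)] — Theorem 12.5 (`RelaxationTimeLowerBound.LevinPeres2017_thm_12_5`) at an
  eigenvalue attaining `λ⋆`.
-/

namespace Literature.Probability.MarkovChains

open Finset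

variable {X : Type*} [Fintype X] [DecidableEq X]

/-- The set of eigenvalues `λ ≠ 1` of the (complexified) transition matrix.
[cite: LevinPeres2017, §12.2 eq. (12.6)] -/
def nontrivialEigenvalues (P : X → X → ℝ) : Set ℂ :=
  {μ | Module.End.HasEigenvalue (Matrix.toLin' (fun x y => (P x y : ℂ))) μ ∧ μ ≠ 1}

/-- The set of eigenvalues `≠ 1` is finite. [cite: LevinPeres2017, §12.2 eq. (12.6) (a `max` over
finitely many eigenvalues)] -/
theorem nontrivialEigenvalues_finite (P : X → X → ℝ) : (nontrivialEigenvalues P).Finite :=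
  (Module.End.finite_hasEigenvalue _).subset fun _ hμ => hμ.1

/-- `λ⋆ = max {|λ| : λ an eigenvalue of P, λ ≠ 1}` (junk value `sSup ∅ = 0` when there is no such
eigenvalue). [cite: LevinPeres2017, §12.2 eq. (12.6)] -/
noncomputable def lambdaStar (P : X → X → ℝ) : ℝ :=
  sSup ((fun μ : ℂ => ‖μ‖) '' nontrivialEigenvalues P)

/-- The absolute spectral gap `γ⋆ = 1 − λ⋆`. [cite: LevinPeres2017, §12.2 (display after
eq. (12.6))] -/
noncomputable def absSpectralGap (P : X → X → ℝ) : ℝ := 1 - lambdaStar P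

/-- The relaxation time `t_rel = 1/γ⋆` (junk value `1/0 = 0` when `γ⋆ = 0`).
[cite: LevinPeres2017, §12.2 (definition of `t_rel`)] -/
noncomputable def relaxationTime (P : X → X → ℝ) : ℝ := 1 / absSpectralGap P

/-- `|λ| ≤ λ⋆` for every eigenvalue `λ ≠ 1`. [cite: LevinPeres2017, §12.2 eq. (12.6)] -/
theorem norm_le_lambdaStar {P : X → X → ℝ} {μ : ℂ} (hμ : μ ∈ nontrivialEigenvalues P) :
    ‖μ‖ ≤ lambdaStar P :=
  le_csSup ((nontrivialEigenvalues_finite P).image _).bddAbove ⟨μ, hμ, rfl⟩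

/-- `λ⋆ ≥ 0`. [cite: LevinPeres2017, §12.2 eq. (12.6)] -/
theorem lambdaStar_nonneg (P : X → X → ℝ) : 0 ≤ lambdaStar P := by
  unfold lambdaStar
  by_cases hne : ((fun μ : ℂ => ‖μ‖) '' nontrivialEigenvalues P).Nonempty
  · obtain ⟨_, ⟨μ, hμ, rfl⟩⟩ := hne
    exact (norm_nonneg μ).trans (norm_le_lambdaStar hμ)
  · rw [Set.not_nonempty_iff_eq_empty.mp hne, Real.sSup_empty]

/-- The maximum in `λ⋆` is attained when `P` has an eigenvalue `≠ 1`.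
[cite: LevinPeres2017, §12.2 eq. (12.6)] -/
theorem exists_norm_eq_lambdaStar {P : X → X → ℝ} (h : (nontrivialEigenvalues P).Nonempty) :
    ∃ μ ∈ nontrivialEigenvalues P, ‖μ‖ = lambdaStar P := by
  have hne : ((fun μ : ℂ => ‖μ‖) '' nontrivialEigenvalues P).Nonempty := h.image _
  obtain ⟨μ, hμ, h⟩ := hne.csSup_mem ((nontrivialEigenvalues_finite P).image _)
  exact ⟨μ, hμ, h⟩

/-- **Lemma 12.1 (i) for `λ⋆`**: `λ⋆ ≤ 1` for a row-stochastic `P`.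
[cite: LevinPeres2017, §12.1 Lemma 12.1 (i)] -/
theorem lambdaStar_le_one {P : X → X → ℝ} (hP : IsRowStochastic P) : lambdaStar P ≤ 1 := by
  by_cases h : (nontrivialEigenvalues P).Nonempty
  · obtain ⟨μ, hμ, hμeq⟩ := exists_norm_eq_lambdaStar h
    obtain ⟨f, hf⟩ := hμ.1.exists_hasEigenvector
    obtain ⟨hf0, hfx⟩ := (hasEigenvector_iff P f μ).mp hf
    rw [← hμeq]
    exact norm_eigenvalue_le_one hP hfx hf0
  · unfold lambdaStar
    rw [Set.not_nonempty_iff_eq_empty.mp h, Set.image_empty, Real.sSup_empty]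
    exact zero_le_one

/-- **Eq. (12.14)**: `(t_rel − 1)·log(1/(2ε)) ≤ t` for every `t` with `d(t) ≤ ε` — for `πP = π`,
`ε > 0` and `λ⋆ < 1` (i.e. `γ⋆ > 0`, which holds for every irreducible aperiodic chain by
Lemma 12.1).  Theorem 12.5 at an eigenvalue attaining `λ⋆`; when `P` has no eigenvalue `≠ 1`
the left side is `0`. [cite: LevinPeres2017, §12.2 Thm 12.5 eq. (12.14)] -/
theorem LevinPeres2017_eq_12_14 {P : X → X → ℝ} {π : X → ℝ} (hπ : IsStationary π P)
    (hgap : lambdaStar P < 1) {ε : ℝ} (hε : 0 < ε) {t : ℕ} (ht : worstTvDist P π t ≤ ε) :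
    (relaxationTime P - 1) * Real.log (1 / (2 * ε)) ≤ t := by
  unfold relaxationTime absSpectralGap
  by_cases h : (nontrivialEigenvalues P).Nonempty
  · obtain ⟨μ, hμ, hμeq⟩ := exists_norm_eq_lambdaStar h
    obtain ⟨f, hf⟩ := hμ.1.exists_hasEigenvector
    obtain ⟨hf0, hfx⟩ := (hasEigenvector_iff P f μ).mp hf
    rw [← hμeq]
    exact LevinPeres2017_thm_12_5 hπ hfx hf0 hμ.2 (hμeq ▸ hgap) hε ht
  · have h0 : lambdaStar P = 0 := by
      unfold lambdaStar
      rw [Set.not_nonempty_iff_eq_empty.mp h, Set.image_empty, Real.sSup_empty]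
    rw [h0]
    norm_num

/-- **Eq. (12.14) for `t_mix(ε)`**: `(t_rel − 1)·log(1/(2ε)) ≤ t_mix(ε)` for a chain that is
`ε`-close at some time (`πP = π`, `ε > 0`, `λ⋆ < 1`).
[cite: LevinPeres2017, §12.2 Thm 12.5 eq. (12.14)] -/
theorem LevinPeres2017_eq_12_14_tmix {P : X → X → ℝ} {π : X → ℝ} (hπ : IsStationary π P)
    (hgap : lambdaStar P < 1) {ε : ℝ} (hε : 0 < ε) (hmix : ∃ t, worstTvDist P π t ≤ ε) :
    (relaxationTime P - 1) * Real.log (1 / (2 * ε)) ≤ (mixingTime P π ε : ℝ) := by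
  obtain ⟨t₀, ht₀⟩ := hmix
  exact LevinPeres2017_eq_12_14 hπ hgap hε (worstTvDist_mixingTime_le P π ht₀)

end Literature.Probability.MarkovChains
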